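import Literature.AlgebraicGeometry.Modules.SerreTwistSegreOver
import Literature.AlgebraicGeometry.Morphisms.GraphFamilyHilbertPolynomial
import Literature.AlgebraicGeometry.Modules.UnitCocyclePresented
import HarnessLib

/-!
# Graph families with isomorphic `𝒪(1)` have the same Hilbert letters; the letters of the graphs of all fibre isomorphisms
# `G : (Y₁)_t ⥲ (Y₂)_t` with `G^*𝒪_{j₂}(1)| ≅ 𝒪_{j₁}(1)|` form a FINITE set (they are letters of the DIAGONAL of `Y₁`, locally constant on the base)

Layer `Literature/AlgebraicGeometry/Morphisms`, namespace `Literature.AlgebraicGeometry.Morphisms`.  THEOREMS ONLY (no definition, no named fact, no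
instance, no notation, no `sorry`); universe `0`.  Cell `hodgecm-mathlib` (D-0151), P6 «MOD programme», organ «stub_ILET» FILE B2 (generic core;
B-p10 (g29); road = A-p14 (g34): reference family = the graph of the identity through the Segre product embedding into the SAME ambient `𝐏`,
★ (C) `graphFamily_hilbertPolynomial_decomposition`, transport of letters along module isomorphisms ★ `HilbertLetterTransport`, Segre `𝒪(1)`
★ `SerreTwistSegreOver`).  The line `Cruxes/HLiu418/Lines/F0_P6a_IsomSchemeFiniteType.lean` reads the sequel's head with `Yᵢ := 𝒜ᵢ.X`, `Nᵢ := L^Δ(λᵢ)^{⊗k}` and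
the iso of ★ `nonempty_pullback_LDelta_tensorPow_iso_of_tupleIso`; its `def`s `GraphLetters`∕`prodEmb` are spelled out (a Lines file is not importable).
Count-neutral: HC_CM is proved only modulo the printed citations until rung 0 closes.

* §1 `detClass_pullback_twistMod_graphFamily` ∕ `nonempty_pullback_twistMod_graphFamily_iso_tensorPow` — for ANY base `v : T′ → Y`, `T′`-morphism
  `φ : Y₁ ×_Y T′ → Y₂ ×_Y T′`, graph family `iΓ` of `φ` through `σ₁₂ := ((j₁ ⊗ j₂) ≫ segreOver).left` and iso `φ^*(N₂|) ≅ N₁|` (`𝒪_{jᵢ}(1) ≅ Nᵢ`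
  of rank one): **`k^*𝒪_Γ(e) ≅ (k^*(N₁|))^{⊗2e}`** at every `k : X′ → Y₁ ×_Y T′` (classes in `Ȟ¹(X′, 𝒪^×)`).
* §2 `exists_refLetters` (★ (C) at `v := 𝟙`, `φ := 𝟙`: the diagonal has a locally constant letter function) ∕ `graphLetters_of_refLetters` (the
  letters of any graph family of `G` at a field point are the reference letters under `t`: §1 twice + ★ `letters_iff_of_iso`).
* The HEAD (finite letter set `F`, both directions `G`/`Ginv`) is the sequel `Morphisms/GraphFamilyLettersFinite.lean`.

## References
* [MumfordFogartyKirwan1994] D. Mumford, J. Fogarty, F. Kirwan, *Geometric Invariant Theory*, 3rd ed. (1994), Ch. 0 §5 (c) (p. 23), Ch. 7 §2 Prop. 7.3 (p. 132).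
* [EGAIII2] A. Grothendieck, J. Dieudonné, *EGA III₂* (1963), 7.9.11.
* [Hartshorne1977] R. Hartshorne, *Algebraic Geometry* (1977), II Ex. 5.11 (p. 125), II Thm. 7.1 (p. 150), III Thm. 9.9 (p. 261).
* [StacksProject] The Stacks Project, Tags 01WD, 01NF.
-/

noncomputable section

-- `TopCat.Presheaf`/`Scheme.Modules` bookkeeping (as in ★ `Morphisms/GraphFamilyHilbertPolynomial`).
set_option backward.isDefEq.respectTransparency false

open CategoryTheory CategoryTheory.Limits CategoryTheory.Abelian AlgebraicGeometry TopologicalSpace Opposite MonoidalCategory Polynomial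

namespace Literature.AlgebraicGeometry.Morphisms

open Literature.AlgebraicGeometry.Modules Literature.AlgebraicGeometry.Modules.SerreTwist Literature.AlgebraicGeometry.Motives
open Literature.AlgebraicGeometry.Morphisms.ProjCech Literature.Algebra.Homology Literature.Algebra.Homology.LaurentCech

/-! ## §1 The class of `𝒪_Γ(e)` for a graph family whose `φ` identifies the two `𝒪(1)`'s -/

section GraphClass

variable {ι κ τ : Type} {Y : Scheme.{0}} (ε : Fin (Nat.card ι + 1) × Fin (Nat.card κ + 1) ≃ Fin (Nat.card τ + 1))
  (Y₁ Y₂ : Over Y)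
  (j₁ : Y₁.left ⟶ Morphisms.projectiveSpace ι Y) (hj₁ : j₁ ≫ Morphisms.projectiveSpaceFst ι Y = Y₁.hom)
  (j₂ : Y₂.left ⟶ Morphisms.projectiveSpace κ Y) (hj₂ : j₂ ≫ Morphisms.projectiveSpaceFst κ Y = Y₂.hom)
  {N₁ : Y₁.left.Modules} {N₂ : Y₂.left.Modules} (hN₁ : HasRank N₁ 1) (hN₂ : HasRank N₂ 1)
  (ψ₁ : twistMod (j₁ ≫ pullback.snd (terminal.from Y) (terminal.from (Morphisms.projectiveSpaceInt ι))) (unitModule _) 1 ≅ N₁)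
  (ψ₂ : twistMod (j₂ ≫ pullback.snd (terminal.from Y) (terminal.from (Morphisms.projectiveSpaceInt κ))) (unitModule _) 1 ≅ N₂)
  {T' : Scheme.{0}} (v : T' ⟶ Y) (φ : pullback Y₁.hom v ⟶ pullback Y₂.hom v)
  (hw : pullback.fst Y₁.hom v ≫ Y₁.hom = (φ ≫ pullback.fst Y₂.hom v) ≫ Y₂.hom)
  (iΓ : pullback Y₁.hom v ⟶ Morphisms.projectiveSpace τ T')
  (h₂ : iΓ ≫ Morphisms.projectiveSpaceMap τ v =
    pullback.lift (pullback.fst Y₁.hom v) (φ ≫ pullback.fst Y₂.hom v) hw ≫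
      ((Over.homMk j₁ hj₁ ⊗ₘ Over.homMk j₂ hj₂ :
        Y₁ ⊗ Y₂ ⟶ Over.mk (Morphisms.projectiveSpaceFst ι Y) ⊗ Over.mk (Morphisms.projectiveSpaceFst κ Y)) ≫
        Morphisms.segreOver Y ε).left)
  (χ : Nonempty ((Scheme.Modules.pullback φ).obj ((Scheme.Modules.pullback (pullback.fst Y₂.hom v)).obj N₂) ≅
    (Scheme.Modules.pullback (pullback.fst Y₁.hom v)).obj N₁))

/-- Equal morphisms to `𝐏ʳ` have twists `𝒪(m)` with equal classes. [folklore] -/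
private theorem detClass_twistMod_congr_of_eq {X : Scheme.{0}} {r : ℕ} {a b : X ⟶ PP intU.{0} r} (h : a = b) (m : ℕ) :
    detClass (isFiniteLocallyFree_twistMod_unitModule a m) = detClass (isFiniteLocallyFree_twistMod_unitModule b m) := by
  subst h; rfl

/-- `[𝒪(m)]_{k ≫ φ} = k^*[𝒪(m)]_φ` (★ `detClass_serreTwist_comp` through `𝒪(m) = 𝒪(−m)^∨`). [cite: Hartshorne1977, II Prop. 5.12 (c) (p. 117)] -/
private theorem detClass_twistMod_comp {X X' : Scheme.{0}} {r : ℕ} (k : X' ⟶ X) (a : X ⟶ PP intU.{0} r) (m : ℕ) :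
    detClass (isFiniteLocallyFree_twistMod_unitModule (k ≫ a) m) =
      CechPic.pullback k (detClass (isFiniteLocallyFree_twistMod_unitModule a m)) := by
  rw [detClass_twistMod_unitModule_eq_inv, detClass_twistMod_unitModule_eq_inv, detClass_serreTwist_comp, map_inv]

include hN₁ hN₂ ψ₁ ψ₂ h₂ χ in
/-- **THE CLASS OF `k^*𝒪_Γ(e)` IS `(k^*[N₁|])^{2e}`** for a graph family `iΓ` of `φ` through the product embedding `σ₁₂ = ((j₁ ⊗ j₂) ≫ segreOver).left`
when `φ^*(N₂|) ≅ N₁|`: `𝒪_Γ(1) = (graph_φ ≫ σ₁₂)^*𝒪(1)` (`𝐏(v) ≫ pr₂ = pr₂`) `= pr_v^*N₁ ⊗ φ^*pr_v^*N₂` (★ `detClass_twistMod_prodSegre`) `≅ (pr_v^*N₁)^{⊗2}`,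
and `𝒪_Γ(e) = 𝒪_Γ(1)^{⊗e}` (★ `detClass_twistMod_unitModule_eq_pow`). [cite: Hartshorne1977, II Ex. 5.11 (p. 125) and II Thm. 7.1 (p. 150)]
[cite: MumfordFogartyKirwan1994, Ch. 0 §5 (c) (p. 23)] -/
theorem detClass_pullback_twistMod_graphFamily {X' : Scheme.{0}} (k : X' ⟶ pullback Y₁.hom v) (e : ℕ) :
    detClass ((isFiniteLocallyFree_twistMod_unitModule
        (iΓ ≫ pullback.snd (terminal.from T') (terminal.from (Morphisms.projectiveSpaceInt τ))) e).pullback k) =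
      CechPic.pullback k (CechPic.pullback (pullback.fst Y₁.hom v) (detClass (HasRank.isFiniteLocallyFree' hN₁))) ^ (2 * e) := by
  obtain ⟨χ⟩ := χ
  -- `iΓ ≫ pr₂ = graph ≫ σ₁₂ ≫ pr₂`
  have hsnd : iΓ ≫ pullback.snd (terminal.from T') (terminal.from (Morphisms.projectiveSpaceInt τ)) =
      pullback.lift (pullback.fst Y₁.hom v) (φ ≫ pullback.fst Y₂.hom v) hw ≫
        (((Over.homMk j₁ hj₁ ⊗ₘ Over.homMk j₂ hj₂ :
          Y₁ ⊗ Y₂ ⟶ Over.mk (Morphisms.projectiveSpaceFst ι Y) ⊗ Over.mk (Morphisms.projectiveSpaceFst κ Y)) ≫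
          Morphisms.segreOver Y ε).left ≫ pullback.snd (terminal.from Y) (terminal.from (Morphisms.projectiveSpaceInt τ))) := by
    rw [← Category.assoc, ← h₂, Category.assoc, Morphisms.projectiveSpaceMap_snd]
  -- classes on `Y₁ ×_Y T′`
  have hN₁f := HasRank.isFiniteLocallyFree' hN₁
  have hN₂f := HasRank.isFiniteLocallyFree' hN₂
  have e₁ : detClass (isFiniteLocallyFree_twistMod_unitModule
      (j₁ ≫ pullback.snd (terminal.from Y) (terminal.from (Morphisms.projectiveSpaceInt ι))) 1) = detClass hN₁f :=
    detClass_eq_of_iso ψ₁ _ _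
  have e₂ : detClass (isFiniteLocallyFree_twistMod_unitModule
      (j₂ ≫ pullback.snd (terminal.from Y) (terminal.from (Morphisms.projectiveSpaceInt κ))) 1) = detClass hN₂f :=
    detClass_eq_of_iso ψ₂ _ _
  have eχ : CechPic.pullback φ (CechPic.pullback (pullback.fst Y₂.hom v) (detClass hN₂f)) =
      CechPic.pullback (pullback.fst Y₁.hom v) (detClass hN₁f) := by
    rw [← detClass_pullback (pullback.fst Y₂.hom v) hN₂f, ← detClass_pullback φ (hN₂f.pullback _),
      ← detClass_pullback (pullback.fst Y₁.hom v) hN₁f]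
    exact detClass_eq_of_iso χ _ _
  have h1 : detClass (isFiniteLocallyFree_twistMod_unitModule
      (iΓ ≫ pullback.snd (terminal.from T') (terminal.from (Morphisms.projectiveSpaceInt τ))) 1) =
      CechPic.pullback (pullback.fst Y₁.hom v) (detClass hN₁f) ^ 2 := by
    rw [detClass_twistMod_congr_of_eq hsnd, detClass_twistMod_comp, detClass_twistMod_prodSegre, map_mul,
      ← CechPic.pullback_comp, ← CechPic.pullback_comp, pullback.lift_fst, pullback.lift_snd, e₁, e₂, CechPic.pullback_comp, eχ, sq]
  rw [detClass_pullback (hE := isFiniteLocallyFree_twistMod_unitModule _ e), detClass_twistMod_unitModule_eq_pow _ e, h1, map_pow,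
    map_pow, ← pow_mul]

include hN₁ hN₂ ψ₁ ψ₂ h₂ χ in
/-- **`k^*𝒪_Γ(e) ≅ (k^*(N₁|))^{⊗2e}`** (rank-one modules with equal classes, from `detClass_pullback_twistMod_graphFamily`).
[cite: Hartshorne1977, II Thm. 7.1 (p. 150) and III Ex. 4.5] -/
theorem nonempty_pullback_twistMod_graphFamily_iso_tensorPow {X' : Scheme.{0}} (k : X' ⟶ pullback Y₁.hom v) (e : ℕ) :
    Nonempty ((Scheme.Modules.pullback k).obj
        (twistMod (iΓ ≫ pullback.snd (terminal.from T') (terminal.from (Morphisms.projectiveSpaceInt τ))) (unitModule _) e) ≅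
      tensorPow ((Scheme.Modules.pullback k).obj ((Scheme.Modules.pullback (pullback.fst Y₁.hom v)).obj N₁)) (2 * e)) := by
  have hN₁f := HasRank.isFiniteLocallyFree' hN₁
  have hk : HasRank ((Scheme.Modules.pullback k).obj ((Scheme.Modules.pullback (pullback.fst Y₁.hom v)).obj N₁)) 1 :=
    hasRank_pullback k (hasRank_pullback _ hN₁)
  refine (nonempty_iso_iff_detClass_eq (hasRank_pullback k (hasRank_twistMod_unitModule _ e)) (hasRank_tensorPow_one hk (2 * e))
    ((isFiniteLocallyFree_twistMod_unitModule _ e).pullback k)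
    (isFiniteLocallyFree_tensorPow ((hN₁f.pullback _).pullback k) (2 * e))).2 ?_
  rw [detClass_pullback_twistMod_graphFamily ε Y₁ Y₂ j₁ hj₁ j₂ hj₂ hN₁ hN₂ ψ₁ ψ₂ v φ hw iΓ h₂ χ k e,
    detClass_tensorPow hk ((hN₁f.pullback _).pullback k) (2 * e), detClass_pullback k (hN₁f.pullback _), detClass_pullback _ hN₁f]

end GraphClass

/-! ## §2 Reference families and the transfer -/

section Transfer

variable {Y : Scheme.{0}} {n : ℕ}

/-- The product embedding of two closed `Y`-immersions is a closed immersion (Mathlib `MorphismProperty.pullbackMap`, ★ `isClosedImmersion_segreOver_left`).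
[cite: StacksProject, Tag 01WD] -/
theorem isClosedImmersion_prodSegre {ι κ τ : Type} (ε : Fin (Nat.card ι + 1) × Fin (Nat.card κ + 1) ≃ Fin (Nat.card τ + 1))
    (Ya Yb : Over Y) (ja : Ya.left ⟶ Morphisms.projectiveSpace ι Y) (hja : ja ≫ Morphisms.projectiveSpaceFst ι Y = Ya.hom)
    (jb : Yb.left ⟶ Morphisms.projectiveSpace κ Y) (hjb : jb ≫ Morphisms.projectiveSpaceFst κ Y = Yb.hom)
    [IsClosedImmersion ja] [IsClosedImmersion jb] :
    IsClosedImmersion (((Over.homMk ja hja ⊗ₘ Over.homMk jb hjb :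
        Ya ⊗ Yb ⟶ Over.mk (Morphisms.projectiveSpaceFst ι Y) ⊗ Over.mk (Morphisms.projectiveSpaceFst κ Y)) ≫
        Morphisms.segreOver Y ε).left) := by
  have h : IsClosedImmersion ((Over.homMk ja hja ⊗ₘ Over.homMk jb hjb :
      Ya ⊗ Yb ⟶ Over.mk (Morphisms.projectiveSpaceFst ι Y) ⊗ Over.mk (Morphisms.projectiveSpaceFst κ Y)).left) := by
    rw [Over.tensorHom_left]
    exact MorphismProperty.pullbackMap (P := @IsClosedImmersion) (i₁ := ja) (i₂ := jb) inferInstance inferInstance hja.symm hjb.symm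
  rw [Over.comp_left]
  infer_instance

/-- `𝐏(ι; 𝟙_S) = 𝟙`. [cite: StacksProject, Tag 01NF] -/
theorem projectiveSpaceMap_id' (ι : Type) (S : Scheme.{0}) : Morphisms.projectiveSpaceMap ι (𝟙 S) = 𝟙 _ := by
  apply pullback.hom_ext
  · rw [Morphisms.projectiveSpaceMap_fst, Category.id_comp, Category.comp_id]
  · rw [Morphisms.projectiveSpaceMap_snd, Category.id_comp]

/-- The product embedding lies over `Y`: `σ ≫ pr₁ = fst ≫ Ya.hom`. [cite: StacksProject, Tag 01WD] -/
theorem prodSegre_fst {ι κ τ : Type} (ε : Fin (Nat.card ι + 1) × Fin (Nat.card κ + 1) ≃ Fin (Nat.card τ + 1))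
    (Ya Yb : Over Y) (ja : Ya.left ⟶ Morphisms.projectiveSpace ι Y) (hja : ja ≫ Morphisms.projectiveSpaceFst ι Y = Ya.hom)
    (jb : Yb.left ⟶ Morphisms.projectiveSpace κ Y) (hjb : jb ≫ Morphisms.projectiveSpaceFst κ Y = Yb.hom) :
    ((Over.homMk ja hja ⊗ₘ Over.homMk jb hjb :
        Ya ⊗ Yb ⟶ Over.mk (Morphisms.projectiveSpaceFst ι Y) ⊗ Over.mk (Morphisms.projectiveSpaceFst κ Y)) ≫
        Morphisms.segreOver Y ε).left ≫ Morphisms.projectiveSpaceFst τ Y = pullback.fst Ya.hom Yb.hom ≫ Ya.hom :=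
  Over.w _

/-- **REFERENCE LETTERS.**  For `Ya → Y` flat over a Noetherian `Y` with a closed `Y`-immersion `ja : Ya ↪ 𝐏(Fin n; Y)`, `1 ≤ n`, the DIAGONAL
graph family `iΓa = graph(𝟙) ≫ σaa : Ya ×_Y Y ↪ 𝐏(Fin (n² + 2n); Y)` (a graph family of `φ := 𝟙` over `v := 𝟙_Y`) has a locally constant
letter function `P : Y → ℚ[X]` (★ (C) `graphFamily_hilbertPolynomial_decomposition`): at every field point `x : Spec K → Y` through `y` and every
cartesian `k : X₀ → Ya ×_Y Y` over `x`, `Ext¹(𝒪, k^*𝒪_Γ(e)) = 0` and `dim Γ(k^*𝒪_Γ(e)) = P(y)(e)` for `e ≥ B(P y) − 1`.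
[cite: MumfordFogartyKirwan1994, Ch. 0 §5 (c) (p. 23)] [cite: EGAIII2, 7.9.11] -/
theorem exists_refLetters [IsNoetherian Y] (Ya : Over Y) [Flat Ya.hom] (ja : Ya.left ⟶ Morphisms.projectiveSpace (Fin n) Y)
    (hja : ja ≫ Morphisms.projectiveSpaceFst (Fin n) Y = Ya.hom) [IsClosedImmersion ja] (hn : 1 ≤ n) :
    ∃ (P : Y → ℚ[X]) (iΓa : pullback Ya.hom (𝟙 Y) ⟶ Morphisms.projectiveSpace (Fin (n * n + n + n)) Y)
      (hwa : pullback.fst Ya.hom (𝟙 Y) ≫ Ya.hom = (𝟙 _ ≫ pullback.fst Ya.hom (𝟙 Y)) ≫ Ya.hom),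
      IsLocallyConstant P ∧ iΓa ≫ Morphisms.projectiveSpaceFst (Fin (n * n + n + n)) Y = pullback.snd Ya.hom (𝟙 Y) ∧
      iΓa ≫ Morphisms.projectiveSpaceMap (Fin (n * n + n + n)) (𝟙 Y) =
        pullback.lift (pullback.fst Ya.hom (𝟙 Y)) (𝟙 _ ≫ pullback.fst Ya.hom (𝟙 Y)) hwa ≫
          ((Over.homMk ja hja ⊗ₘ Over.homMk ja hja :
            Ya ⊗ Ya ⟶ Over.mk (Morphisms.projectiveSpaceFst (Fin n) Y) ⊗ Over.mk (Morphisms.projectiveSpaceFst (Fin n) Y)) ≫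
            Morphisms.segreOver Y (Morphisms.segreIndexEquivFin n n)).left ∧
      ∀ ⦃K : Type⦄ [Field K] ⦃X₀ : Scheme.{0}⦄ (k : X₀ ⟶ pullback Ya.hom (𝟙 Y)) (f₀ : X₀ ⟶ Spec (CommRingCat.of K))
        (x : Spec (CommRingCat.of K) ⟶ Y), IsPullback k f₀ (iΓa ≫ Morphisms.projectiveSpaceFst (Fin (n * n + n + n)) Y) x →
        ∀ y : Y, y ∈ Set.range x.base →
        ∀ e : ℕ, regularityBound (preHilbertPoly ℚ (Nat.card (Fin (n * n + n + n))) 0) 0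
            (preHilbertPoly ℚ (Nat.card (Fin (n * n + n + n))) 0 - P y) - 1 ≤ (e : ℤ) →
          Subsingleton (CategoryTheory.Abelian.Ext.{1} (unitModule X₀) ((Scheme.Modules.pullback k).obj
            (twistMod (iΓa ≫ pullback.snd (terminal.from Y) (terminal.from (Morphisms.projectiveSpaceInt (Fin (n * n + n + n)))))
              (unitModule _) e)) 1) ∧
          ((Module.finrank Γ(Spec (CommRingCat.of K), ⊤) (SecMod ((Scheme.Modules.pullback k).obj
            (twistMod (iΓa ≫ pullback.snd (terminal.from Y) (terminal.from (Morphisms.projectiveSpaceInt (Fin (n * n + n + n)))))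
              (unitModule _) e)) f₀.appTop.hom ⊤) : ℕ) : ℚ) = (P y).eval (e : ℚ) := by
  have hτ : 1 ≤ Nat.card (Fin (n * n + n + n)) := by rw [Nat.card_fin]; exact hn.trans (Nat.le_add_left n _)
  haveI := isClosedImmersion_prodSegre (Morphisms.segreIndexEquivFin n n) Ya Ya ja hja ja hja
  have hσ := prodSegre_fst (Morphisms.segreIndexEquivFin n n) Ya Ya ja hja ja hja
  have hwa : pullback.fst Ya.hom (𝟙 Y) ≫ Ya.hom = (𝟙 _ ≫ pullback.fst Ya.hom (𝟙 Y)) ≫ Ya.hom := by rw [Category.id_comp]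
  have h₁ : (pullback.lift (pullback.fst Ya.hom (𝟙 Y)) (𝟙 _ ≫ pullback.fst Ya.hom (𝟙 Y)) hwa ≫
      ((Over.homMk ja hja ⊗ₘ Over.homMk ja hja :
        Ya ⊗ Ya ⟶ Over.mk (Morphisms.projectiveSpaceFst (Fin n) Y) ⊗ Over.mk (Morphisms.projectiveSpaceFst (Fin n) Y)) ≫
        Morphisms.segreOver Y (Morphisms.segreIndexEquivFin n n)).left) ≫ Morphisms.projectiveSpaceFst (Fin (n * n + n + n)) Y =
      pullback.snd Ya.hom (𝟙 Y) := by
    rw [Category.assoc, hσ, pullback.lift_fst_assoc, pullback.condition, Category.comp_id]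
  have h₂ : (pullback.lift (pullback.fst Ya.hom (𝟙 Y)) (𝟙 _ ≫ pullback.fst Ya.hom (𝟙 Y)) hwa ≫
      ((Over.homMk ja hja ⊗ₘ Over.homMk ja hja :
        Ya ⊗ Ya ⟶ Over.mk (Morphisms.projectiveSpaceFst (Fin n) Y) ⊗ Over.mk (Morphisms.projectiveSpaceFst (Fin n) Y)) ≫
        Morphisms.segreOver Y (Morphisms.segreIndexEquivFin n n)).left) ≫ Morphisms.projectiveSpaceMap (Fin (n * n + n + n)) (𝟙 Y) =
      pullback.lift (pullback.fst Ya.hom (𝟙 Y)) (𝟙 _ ≫ pullback.fst Ya.hom (𝟙 Y)) hwa ≫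
      ((Over.homMk ja hja ⊗ₘ Over.homMk ja hja :
        Ya ⊗ Ya ⟶ Over.mk (Morphisms.projectiveSpaceFst (Fin n) Y) ⊗ Over.mk (Morphisms.projectiveSpaceFst (Fin n) Y)) ≫
        Morphisms.segreOver Y (Morphisms.segreIndexEquivFin n n)).left := by
    rw [projectiveSpaceMap_id']
    exact Category.comp_id _
  obtain ⟨P, hP, -, hlet⟩ := graphFamily_hilbertPolynomial_decomposition Ya.hom Ya.hom hτ _ hσ (𝟙 Y) (𝟙 _) (Category.id_comp _) hwa _ h₁ h₂
  exact ⟨P, _, hwa, hP, h₁, h₂, hlet⟩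

/-- **TRANSFER OF LETTERS FROM THE REFERENCE.**  Closed `Y`-immersions `ja, jb` into `𝐏(Fin n; Y)` with `𝒪_{ja}(1) ≅ Na`, `𝒪_{jb}(1) ≅ Nb` of rank
one; a reference graph family `iΓa` of `𝟙_{Ya}` through `σaa` with letter function `P` (`exists_refLetters`).  THEN for a field point `t : Spec Ω → Y` and a
`t`-morphism `G : (Ya)_t → (Yb)_t` with `G^*(Nb|) ≅ Na|`, EVERY graph family `iΓ` of `G` through `σab` has at every field point `(k, f₀, x)` the letters
`P(y)`, `y` the point under `t`: by §1 both `k^*𝒪_{Γ_G}(e)` and `(k ≫ c)^*𝒪_{Γa}(e)` (`c : (Ya)_t → Ya ×_Y Y` the comparison, cartesian over `t`) are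
`≅ (k^*(Na|))^{⊗2e}`, and letters are invariant under isomorphism (★ `letters_iff_of_iso`). [cite: MumfordFogartyKirwan1994, Ch. 0 §5 (c) (p. 23)] -/
theorem graphLetters_of_refLetters (Ya Yb : Over Y) (ja : Ya.left ⟶ Morphisms.projectiveSpace (Fin n) Y)
    (hja : ja ≫ Morphisms.projectiveSpaceFst (Fin n) Y = Ya.hom) (jb : Yb.left ⟶ Morphisms.projectiveSpace (Fin n) Y)
    (hjb : jb ≫ Morphisms.projectiveSpaceFst (Fin n) Y = Yb.hom) {Na : Ya.left.Modules} {Nb : Yb.left.Modules} (hNa : HasRank Na 1)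
    (hNb : HasRank Nb 1) (ψa : twistMod (ja ≫ pullback.snd (terminal.from Y) (terminal.from (Morphisms.projectiveSpaceInt (Fin n)))) (unitModule _) 1 ≅ Na)
    (ψb : twistMod (jb ≫ pullback.snd (terminal.from Y) (terminal.from (Morphisms.projectiveSpaceInt (Fin n)))) (unitModule _) 1 ≅ Nb)
    (P : Y → ℚ[X]) (iΓa : pullback Ya.hom (𝟙 Y) ⟶ Morphisms.projectiveSpace (Fin (n * n + n + n)) Y)
    (ha₁ : iΓa ≫ Morphisms.projectiveSpaceFst (Fin (n * n + n + n)) Y = pullback.snd Ya.hom (𝟙 Y))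
    (hwa : pullback.fst Ya.hom (𝟙 Y) ≫ Ya.hom = (𝟙 _ ≫ pullback.fst Ya.hom (𝟙 Y)) ≫ Ya.hom)
    (ha₂ : iΓa ≫ Morphisms.projectiveSpaceMap (Fin (n * n + n + n)) (𝟙 Y) =
        pullback.lift (pullback.fst Ya.hom (𝟙 Y)) (𝟙 _ ≫ pullback.fst Ya.hom (𝟙 Y)) hwa ≫
          ((Over.homMk ja hja ⊗ₘ Over.homMk ja hja :
            Ya ⊗ Ya ⟶ Over.mk (Morphisms.projectiveSpaceFst (Fin n) Y) ⊗ Over.mk (Morphisms.projectiveSpaceFst (Fin n) Y)) ≫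
            Morphisms.segreOver Y (Morphisms.segreIndexEquivFin n n)).left)
    (hP : ∀ ⦃K : Type⦄ [Field K] ⦃X₀ : Scheme.{0}⦄ (k : X₀ ⟶ pullback Ya.hom (𝟙 Y)) (f₀ : X₀ ⟶ Spec (CommRingCat.of K))
        (x : Spec (CommRingCat.of K) ⟶ Y), IsPullback k f₀ (iΓa ≫ Morphisms.projectiveSpaceFst (Fin (n * n + n + n)) Y) x →
        ∀ y : Y, y ∈ Set.range x.base →
        ∀ e : ℕ, regularityBound (preHilbertPoly ℚ (Nat.card (Fin (n * n + n + n))) 0) 0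
            (preHilbertPoly ℚ (Nat.card (Fin (n * n + n + n))) 0 - P y) - 1 ≤ (e : ℤ) →
          Subsingleton (CategoryTheory.Abelian.Ext.{1} (unitModule X₀) ((Scheme.Modules.pullback k).obj
            (twistMod (iΓa ≫ pullback.snd (terminal.from Y) (terminal.from (Morphisms.projectiveSpaceInt (Fin (n * n + n + n)))))
              (unitModule _) e)) 1) ∧
          ((Module.finrank Γ(Spec (CommRingCat.of K), ⊤) (SecMod ((Scheme.Modules.pullback k).obj
            (twistMod (iΓa ≫ pullback.snd (terminal.from Y) (terminal.from (Morphisms.projectiveSpaceInt (Fin (n * n + n + n)))))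
              (unitModule _) e)) f₀.appTop.hom ⊤) : ℕ) : ℚ) = (P y).eval (e : ℚ))
    ⦃Ω : Type⦄ [Field Ω] (t : Spec (CommRingCat.of Ω) ⟶ Y) (G : pullback Ya.hom t ⟶ pullback Yb.hom t)
    (χ : Nonempty ((Scheme.Modules.pullback G).obj ((Scheme.Modules.pullback (pullback.fst Yb.hom t)).obj Nb) ≅
      (Scheme.Modules.pullback (pullback.fst Ya.hom t)).obj Na))
    (hw : pullback.fst Ya.hom t ≫ Ya.hom = (G ≫ pullback.fst Yb.hom t) ≫ Yb.hom)
    (iΓ : pullback Ya.hom t ⟶ Morphisms.projectiveSpace (Fin (n * n + n + n)) (Spec (CommRingCat.of Ω)))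
    (h₁ : iΓ ≫ Morphisms.projectiveSpaceFst (Fin (n * n + n + n)) (Spec (CommRingCat.of Ω)) = pullback.snd Ya.hom t)
    (h₂ : iΓ ≫ Morphisms.projectiveSpaceMap (Fin (n * n + n + n)) t =
      pullback.lift (pullback.fst Ya.hom t) (G ≫ pullback.fst Yb.hom t) hw ≫
        ((Over.homMk ja hja ⊗ₘ Over.homMk jb hjb :
          Ya ⊗ Yb ⟶ Over.mk (Morphisms.projectiveSpaceFst (Fin n) Y) ⊗ Over.mk (Morphisms.projectiveSpaceFst (Fin n) Y)) ≫
          Morphisms.segreOver Y (Morphisms.segreIndexEquivFin n n)).left)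
    ⦃K : Type⦄ [Field K] ⦃X' : Scheme.{0}⦄ (k : X' ⟶ pullback Ya.hom t) (f₀ : X' ⟶ Spec (CommRingCat.of K))
    (x : Spec (CommRingCat.of K) ⟶ Spec (CommRingCat.of Ω))
    (hk : IsPullback k f₀ (iΓ ≫ Morphisms.projectiveSpaceFst (Fin (n * n + n + n)) (Spec (CommRingCat.of Ω))) x) (e : ℕ)
    (he : regularityBound (preHilbertPoly ℚ (Nat.card (Fin (n * n + n + n))) 0) 0
      (preHilbertPoly ℚ (Nat.card (Fin (n * n + n + n))) 0 - P (t.base (IsLocalRing.closedPoint Ω))) - 1 ≤ (e : ℤ)) :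
    Subsingleton (CategoryTheory.Abelian.Ext.{1} (unitModule X') ((Scheme.Modules.pullback k).obj
      (twistMod (iΓ ≫ pullback.snd (terminal.from (Spec (CommRingCat.of Ω)))
        (terminal.from (Morphisms.projectiveSpaceInt (Fin (n * n + n + n))))) (unitModule _) e)) 1) ∧
    ((Module.finrank Γ(Spec (CommRingCat.of K), ⊤) (SecMod ((Scheme.Modules.pullback k).obj
      (twistMod (iΓ ≫ pullback.snd (terminal.from (Spec (CommRingCat.of Ω)))
        (terminal.from (Morphisms.projectiveSpaceInt (Fin (n * n + n + n))))) (unitModule _) e))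
      f₀.appTop.hom ⊤) : ℕ) : ℚ) = (P (t.base (IsLocalRing.closedPoint Ω))).eval (e : ℚ) := by
  -- the comparison `c : (Ya)_t → Ya ×_Y Y`, cartesian over `t`
  have hc : pullback.fst Ya.hom t ≫ Ya.hom = (pullback.snd Ya.hom t ≫ t) ≫ 𝟙 Y := by rw [Category.comp_id, pullback.condition]
  obtain ⟨c, hc₁, hc₂⟩ : ∃ c : pullback Ya.hom t ⟶ pullback Ya.hom (𝟙 Y), c ≫ pullback.fst Ya.hom (𝟙 Y) = pullback.fst Ya.hom t ∧
      c ≫ pullback.snd Ya.hom (𝟙 Y) = pullback.snd Ya.hom t ≫ t :=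
    ⟨pullback.lift _ _ hc, pullback.lift_fst _ _ _, pullback.lift_snd _ _ _⟩
  have hcsq : IsPullback c (pullback.snd Ya.hom t) (pullback.snd Ya.hom (𝟙 Y)) t := by
    refine IsPullback.of_right ?_ hc₂ (IsPullback.of_hasPullback Ya.hom (𝟙 Y))
    rw [hc₁, Category.comp_id]
    exact IsPullback.of_hasPullback Ya.hom t
  have Hsq : IsPullback (k ≫ c) f₀ (iΓa ≫ Morphisms.projectiveSpaceFst (Fin (n * n + n + n)) Y) (x ≫ t) := by
    rw [ha₁]
    rw [h₁] at hk
    exact hk.paste_horiz hcsq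
  haveI : Subsingleton ↥(Spec (CommRingCat.of Ω)) := inferInstanceAs (Subsingleton (PrimeSpectrum Ω))
  have hy : t.base (IsLocalRing.closedPoint Ω) ∈ Set.range (x ≫ t).base :=
    ⟨IsLocalRing.closedPoint K, by rw [Scheme.Hom.comp_apply]; congr 1; exact Subsingleton.elim _ _⟩
  -- §1 for `Γ_G` and for the reference
  obtain ⟨A⟩ := nonempty_pullback_twistMod_graphFamily_iso_tensorPow (Morphisms.segreIndexEquivFin n n) Ya Yb ja hja jb hjb hNa hNb ψa ψb
    t G hw iΓ h₂ χ k e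
  have χa : Nonempty ((Scheme.Modules.pullback (𝟙 _)).obj ((Scheme.Modules.pullback (pullback.fst Ya.hom (𝟙 Y))).obj Na) ≅
      (Scheme.Modules.pullback (pullback.fst Ya.hom (𝟙 Y))).obj Na) := ⟨(Scheme.Modules.pullbackId _).app _⟩
  obtain ⟨B⟩ := nonempty_pullback_twistMod_graphFamily_iso_tensorPow (Morphisms.segreIndexEquivFin n n) Ya Ya ja hja ja hja hNa hNa ψa ψa
    (𝟙 Y) (𝟙 _) hwa iΓa ha₂ χa (k ≫ c) e
  -- the middle: `((k ≫ c)^*(Na|₁))^{⊗2e} ≅ (k^*(Na|ₜ))^{⊗2e}` (equal classes)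
  have hNaf := HasRank.isFiniteLocallyFree' hNa
  have hr₁ : HasRank ((Scheme.Modules.pullback (k ≫ c)).obj ((Scheme.Modules.pullback (pullback.fst Ya.hom (𝟙 Y))).obj Na)) 1 :=
    hasRank_pullback _ (hasRank_pullback _ hNa)
  have hr₂ : HasRank ((Scheme.Modules.pullback k).obj ((Scheme.Modules.pullback (pullback.fst Ya.hom t)).obj Na)) 1 :=
    hasRank_pullback _ (hasRank_pullback _ hNa)
  obtain ⟨C⟩ : Nonempty (tensorPow ((Scheme.Modules.pullback (k ≫ c)).obj ((Scheme.Modules.pullback (pullback.fst Ya.hom (𝟙 Y))).obj Na)) (2 * e) ≅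
      tensorPow ((Scheme.Modules.pullback k).obj ((Scheme.Modules.pullback (pullback.fst Ya.hom t)).obj Na)) (2 * e)) := by
    refine (nonempty_iso_iff_detClass_eq (hasRank_tensorPow_one hr₁ (2 * e)) (hasRank_tensorPow_one hr₂ (2 * e))
      (isFiniteLocallyFree_tensorPow ((hNaf.pullback _).pullback (k ≫ c)) (2 * e))
      (isFiniteLocallyFree_tensorPow ((hNaf.pullback _).pullback k) (2 * e))).2 ?_
    rw [detClass_tensorPow hr₁ ((hNaf.pullback _).pullback (k ≫ c)) (2 * e), detClass_tensorPow hr₂ ((hNaf.pullback _).pullback k) (2 * e),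
      detClass_pullback (k ≫ c) (hNaf.pullback _), detClass_pullback k (hNaf.pullback _), detClass_pullback _ hNaf, detClass_pullback _ hNaf,
      CechPic.pullback_comp, ← CechPic.pullback_comp c, hc₁]
  -- transfer the reference letters along `B ≪≫ C ≪≫ A⁻¹`
  obtain ⟨hv, hd⟩ := hP (k ≫ c) f₀ (x ≫ t) Hsq _ hy e he
  have L := letters_iff_of_iso (B ≪≫ C ≪≫ A.symm) (unitModule X') 1 f₀.appTop.hom
  exact ⟨L.1.mp hv, L.2 ▸ hd⟩

end Transfer


end Literature.AlgebraicGeometry.Morphisms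

end
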